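/-
Origin: expansion seat `planner-pub-hodgecm-mc-glue-1-g11-0`, handover #SG16 2026-08-20T16:55:47Z md5 895c79fee3a4 (REPLACE; pre md5 7e5d407f92ef → new md5 895c79fee3a4; 227 l.; (μ4) scope-guard rewrite of the RUN-55 installed file; family glue-1; compiled ok 0 proof-hole) (`HOME/mc/pub-hodgecm-mc-glue-1-g11/stage56/HodgeCM/Model/E2InstanceOGR21AEPISC.lean`, md5 895c79fee3a4, 227 lines);
landed by the second packager p2 gen 10 (p2-g10) in gate run 56 REPLACES the earlier landed copy of `HodgeCM/Model/E2InstanceOGR21AEPISC.lean` (seat copy carried the packager Origin header of an earlier run (stripped)).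
-/
/-
Origin: CONSTRUCTION seat `planner-pub-hodgecm-mc-glue-1-g10-0` (unit pub-hodgecm-mc-glue-1-g10, gen 10 of mc-glue-1, node E ASSEMBLER),
generated from the installed `HodgeCM/Model/E2InstanceOGR21AEPIS.lean` (RUN-42 #395) and the `variable` texts of `HodgeCM/Model/ArchKTypeOfSide.lean`
(carch-1 RUN-42 #CA19) by `tools/gen_ogisc.py`; KERNEL only: 1 theorem, 0 defs; intended closure {propext, Classical.choice, Quot.sound}.
The ROW-12/14/15 C PIN CHILD of the S-pinned child (rows `C`, `hpd`, `hk` discharged by carch-1's pin-generic term `archKTypeOfSide` and its two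
hypothesis-free theorems at sinst-1's SROG pin); record status is the lead's ruling, not this file's claim.
-/
import Summits.HodgeConjecture.HodgeCM.Model.E2InstanceOGR21AEPIS
import Summits.HodgeConjecture.HodgeCM.Model.ArchKTypeOfSide
import Summits.HodgeConjecture.HodgeCM.Model.ArchKTypeOfFin_2

/-!
# E2InstanceOGR21AEPISC — the row-12/14/15 C pin child of `perL_picardCM_r21AEOGIS`

`perL_picardCM_r21AEOGISC` = `perL_picardCM_r21AEOGIS` (RUN-42 #395, 21 binder groups; rows 5/13 at sinst-1's OG-guard pin
`SInstance.SROG`) with rows 12 `C`, 14 `hpd`, 15 `hk` DISCHARGED at that pin by carch-1's PIN-GENERIC row-12 term (#CA19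
`Model/ArchKTypeOfSide`): `C := fun V c hV hc h6 hcan k hk N hN => archKTypeOfSide … V c (SROG … V c) (hGR V c) … (EtaChi.η χV χWR V c) …
(SInstance.AR … V c hG) (SInstance.SR_eq_archSideOf … V c hG) hV hcan hpos₀ hpos₁ N Γ₀ rfl harch₀ hfin₀ hχ₀ rfl harch₁ hfin₁ hχ₁ k hk`
with the guard `hG : SInstance.GOG V c := ⟨hcan, (thetaModel_goodCtx_iff …).mp hc⟩` (`Automorphic/EndStateFieldCensus`), the slot
positivity facts `SInstance.hpos_GOG`, the plane sign `SInstance.hG_GOG`, the read-off datum `SInstance.AR` (#1212) whose test vectors ARE the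
degree-one line vectors (`arch₀₀ arch₀₁ := rfl`), the supply level `Γ₀ := deepLevel V (deepIndexZero … * deepIndexOne …)` and (D-2)
`hfin₀ hfin₁ := hfin_zero_deepLevel / hfin_one_deepLevel` (#CA18 `Model/ArchKTypeOfFin`); `hpd := isWeaklyPDiff_archKTypeOfSide …`,
`hk := isPMinusKilledAlong_archKTypeOfSide … p` (no hypothesis).  New E-level inputs in their place, each a GUARDED family over
`(V) (c) [(hV)] (hG : SInstance.GOG V c) [(N)]` whose text is #CA19's `variable` text at the pin's η, datum and positivity facts:
`harch₀`/`harch₁` ((c5): the compact archimedean factors at the definite places fix `φ_N(Φ_∞(ℓ))` of line 0/1 — carch-1 PROVE rows,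
cf. #CA20 `harch_zero/one_of_defType`) and `hχ₀`/`hχ₁` ((χ): the (S-norm) scalar identity
on `Stab(x₀)` at the vacuum exponents of line 0/1).  **(C-LINE1) LABEL (model1 l.12748, lead RULING SUPPLEMENT 4 l.12719):** the
line-1 pair `harch₁`/`hχ₁` is, AT THIS PIN (`S := SInstance.SROG`, line-1 character `eta₁ … η`, splitting `(hGR₁ V c).choose`), NOT
DISCHARGEABLE — by carch-1's #CA21 `hχ_one_iff` (`hχ₁ ⟺ (eP, eQ) = (0, −1)`) and `hdef_one_iff` (the definite-type reduction of
`harch₁` ⟺ `a ≡ 0 off v₁`) they are bare identities about an opaque `choose`, unprovable and irrefutable; they are displayed here AS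
TYPED and are NOT PROVE residuals with an owner: under ruling R1 they close PIN-SIDE at the ν-carrying successor of the S pin (sinst-1;
period-1 `Model/ArchSideOfTwist`, carch-1 #CA21 § 4 / #CA22–#CA25 `archKTypeOfSideG`), where this child is re-based mechanically (same
generator, `archKTypeOfSide ↦ archKTypeOfSideG`).  The line-0 pair `harch₀`/`hχ₀` are ordinary carch-1 PROVE inputs ((c5)₀ reduced to one
∞-type identity per definite place by #CA20 `harch_zero_of_defType`; (χ)₀).  Binder groups: `hA W hGR χV hGR₀ hGR₁ hGR₂ hGR₃ μ hΔ₁ hΔ₂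
hΔ₃ hR hΘ harch₀ hχ₀ harch₁ hχ₁ gen12 real34 hyp12 hyp34` (22 = 21 − 3 + 4); every other text is #395's verbatim; conclusion
`Universe.PerL` unchanged; proof = ONE application.  ADDITIVE LEAF; no new definition, record or cite enters; nothing of PerL ∕ QW8 is claimed.
-/

noncomputable section

open scoped TensorProduct InnerProductSpace Matrix

open Literature.NumberTheory.Automorphic Literature.NumberTheory.Weil1964
open Literature.NumberTheory.GelbartRogawski1991.UnitaryDualPair
open HodgeCM.Adelic HodgeCM.PerL34
open scoped Classical
open Literature.Geometry.ComplexHyperbolic.BallModel (U21 x₀ stabilizerEquivK21)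
open Literature.NumberTheory.Automorphic.U21 (K21 matA sclD)

namespace HodgeCM

namespace Model

open HodgeCM.Model.ArchSideTerm
open HodgeCM.Universe (AdelicThetaCore AdelicThetaCore₀ SideData ThetaModel ModelAxiomsPerL)
open Literature.AlgebraicGeometry.HodgeTheory
open Literature.AlgebraicGeometry.ComplexMultiplication (Shimura1998_Thm3_isogenousPower Shimura1998_Thm2_Cor)
open Literature.NumberTheory.Automorphic.PicardCM
open Literature.NumberTheory.Transcendental (Arapura2012_Cor_15_4_6)
open HodgeCM.CMTypeOps (inflate)
open HodgeCM.Model.SupplyResidual (ClassSupplyPackN)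
open HodgeCM.Model.ThetaSpace

variable (hHD : exists_isReal_hodgeModel) (hI : hodgePQ_independent_of_hodgeModel)
  (h₁ : BallQuotientUniformised)  (h₃ : CMAbelianVarietyEigenbasisRealised)

/-- **C-PINNED CHILD of the S-pinned child** (rows 12/14/15 `C` `hpd` `hk` discharged at carch-1's pin-generic `archKTypeOfSide` over
sinst-1's SROG pin, (D-2) at the deep level; residual guarded inputs `harch₀ hχ₀ harch₁ hχ₁`; 22 binder groups).  (C-LINE1) LABEL: the
line-1 pair `harch₁`/`hχ₁` is NOT dischargeable at the `SROG` pin (#CA21 `hχ_one_iff`/`hdef_one_iff`); it closes PIN-SIDE under R1 at the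
ν-carrying successor pin (RULING SUPPLEMENT 4, STATUS l.12719) — displayed AS TYPED, not a PROVE residual with an owner. -/
theorem perL_picardCM_r21AEOGISC (hA : Arapura2012_Cor_15_4_6)
    (W : ∀ {L : CMField} {ι₁ : L →+* ℂ} (V : HermSpace3 L ι₁) (c : SeesawCtx L), WmInput V c.D)
    (hGR : ∀ {L : CMField} {ι₁ : L →+* ℂ} (V : HermSpace3 L ι₁) (c : SeesawCtx L),
      (cmSplittingDatum (L : Type) finProdFinEquiv (frameD V) (frameD_real V) (frameD_ne V) (dW c.D) (dW_real c.D)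
        (dW_ne c.D)).CompatibleSplitting)
    (χV : ∀ {L : CMField} {ι₁ : L →+* ℂ} (_V : HermSpace3 L ι₁) (_c : SeesawCtx L),
      ContinuousMonoidHom (relNormOneIdeles (↥(NumberField.maximalRealSubfield (L : Type))) (L : Type) ⧸
        relNormOneRat (↥(NumberField.maximalRealSubfield (L : Type))) (L : Type)) Circle)
    (hGR₀ : ∀ {L : CMField} {ι₁ : L →+* ℂ} (V : HermSpace3 L ι₁) (c : SeesawCtx L),
      (cmSplittingDatum (L : Type) (e₁) (frameD V) (frameD_real V) (frameD_ne V) (lineVec (L : Type) (dW c.D 0))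
        (fun _ => dW_real c.D 0) (fun _ => dW_ne c.D 0)).CompatibleSplitting)
    (hGR₁ : ∀ {L : CMField} {ι₁ : L →+* ℂ} (V : HermSpace3 L ι₁) (c : SeesawCtx L),
      (cmSplittingDatum (L : Type) (e₁) (frameD V) (frameD_real V) (frameD_ne V) (lineVec (L : Type) (dW c.D 1))
        (fun _ => dW_real c.D 1) (fun _ => dW_ne c.D 1)).CompatibleSplitting)
    (hGR₂ : ∀ {L : CMField} {ι₁ : L →+* ℂ} (V : HermSpace3 L ι₁) (c : SeesawCtx L),
      (cmSplittingDatum (L : Type) (e₁) (frameD V) (frameD_real V) (frameD_ne V) (lineVec (L : Type) (dW' c.D 0))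
        (fun _ => dW'_real c.D 0) (fun _ => dW'_ne c.D 0)).CompatibleSplitting)
    (hGR₃ : ∀ {L : CMField} {ι₁ : L →+* ℂ} (V : HermSpace3 L ι₁) (c : SeesawCtx L),
      (cmSplittingDatum (L : Type) (e₁) (frameD V) (frameD_real V) (frameD_ne V) (lineVec (L : Type) (dW' c.D 1))
        (fun _ => dW'_real c.D 1) (fun _ => dW'_ne c.D 1)).CompatibleSplitting)
    (μ : ∀ {L : CMField}, SeesawCtx L → Fin 4 → NumberField.InfinitePlace L → ℤ)
    (hΔ₁ : ∀ {L : CMField} {ι₁ : L →+* ℂ} (V : HermSpace3 L ι₁) (c : SeesawCtx L), ∀ hc : SInstance.GOG V c,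
      slotTypeVec V c (hGR V c) (hGR₀ V c) (hGR₁ V c) (hGR₂ V c) (hGR₃ V c) (SInstance.hG_GOG V c hc) 1 -
        slotTypeVec V c (hGR V c) (hGR₀ V c) (hGR₁ V c) (hGR₂ V c) (hGR₃ V c) (SInstance.hG_GOG V c hc) 0 = μ c 1 - μ c 0)
    (hΔ₂ : ∀ {L : CMField} {ι₁ : L →+* ℂ} (V : HermSpace3 L ι₁) (c : SeesawCtx L), ∀ hc : SInstance.GOG V c,
      slotTypeVec V c (hGR V c) (hGR₀ V c) (hGR₁ V c) (hGR₂ V c) (hGR₃ V c) (SInstance.hG_GOG V c hc) 2 -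
        slotTypeVec V c (hGR V c) (hGR₀ V c) (hGR₁ V c) (hGR₂ V c) (hGR₃ V c) (SInstance.hG_GOG V c hc) 0 = μ c 2 - μ c 0)
    (hΔ₃ : ∀ {L : CMField} {ι₁ : L →+* ℂ} (V : HermSpace3 L ι₁) (c : SeesawCtx L), ∀ hc : SInstance.GOG V c,
      slotTypeVec V c (hGR V c) (hGR₀ V c) (hGR₁ V c) (hGR₂ V c) (hGR₃ V c) (SInstance.hG_GOG V c hc) 3 -
        slotTypeVec V c (hGR V c) (hGR₀ V c) (hGR₁ V c) (hGR₂ V c) (hGR₃ V c) (SInstance.hG_GOG V c hc) 0 = μ c 3 - μ c 0)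
    (hR : DeligneMilne1982_Thm_6_20_full)
    (hΘ : ∀ {L : CMField} {ι₁ : L →+* ℂ} (V : HermSpace3 L ι₁) (c : SeesawCtx L),
      (thetaModelOf hHD hI h₁ (cmAbelianVarietyRealised_of_eigenbasis hHD hI h₃) (orientBitι L ι₁) (embOf hHD hI h₁ (cmAbelianVarietyRealised_of_eigenbasis hHD hI h₃)) (coverOf hHD hI h₁ (cmAbelianVarietyRealised_of_eigenbasis hHD hI h₃) hA) (wmOfInput W) (thetaOf _ (thetaClassInputOf _ (fun V c => thetaSpaceInputOf hHD hI h₁ (cmAbelianVarietyRealised_of_eigenbasis hHD hI h₃) (SInstance.SROG @hGR @χV @hGR₀ @hGR₁ @hGR₂ @hGR₃ @μ hΔ₁ hΔ₂ hΔ₃) V c))) (d12Of μ) (d34Of μ)).GoodCtx ι₁ c → Module.finrank ℚ c.K = 6 ∧ IsNormalClosure ℚ c.K L ∧ (Module.finrank ℚ L = 24 ∨ Module.finrank ℚ L = 48) →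
      (NumberField.InfinitePlace.mk ι₁).embedding = ι₁ →
      ∀ i : Fin 4, ∃ Γ₀ : Level V, ∀ Γ ≤ Γ₀,
        ∃ D : CommonReflexInput c.K (c.Ψ i) c.σ,
          (thetaModelOf hHD hI h₁ (cmAbelianVarietyRealised_of_eigenbasis hHD hI h₃) (orientBitι L ι₁) (embOf hHD hI h₁ (cmAbelianVarietyRealised_of_eigenbasis hHD hI h₃)) (coverOf hHD hI h₁ (cmAbelianVarietyRealised_of_eigenbasis hHD hI h₃) hA) (wmOfInput W) (thetaOf _ (thetaClassInputOf _ (fun V c => thetaSpaceInputOf hHD hI h₁ (cmAbelianVarietyRealised_of_eigenbasis hHD hI h₃) (SInstance.SROG @hGR @χV @hGR₀ @hGR₁ @hGR₂ @hGR₃ @μ hΔ₁ hΔ₂ hΔ₃) V c))) (d12Of μ) (d34Of μ)).Theta V c i Γ ⊆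
            Submodule.span ℂ (D.surfaceClasses hHD hI h₁ (cmAbelianVarietyRealised_of_eigenbasis hHD hI h₃) V Γ))
    (harch₀ : ∀ {L : CMField} {ι₁ : L →+* ℂ} (V : HermSpace3 L ι₁) (c : SeesawCtx L) (hV : IsAnisotropic L V.Hm) (hG : SInstance.GOG V c) (N : ℕ), ∀ a : UnitaryGroup.arch (↥(NumberField.maximalRealSubfield L)) L (NumberField.IsCMField.complexConj L) 3 V.Hm,
    UnitaryGroup.archAt (↥(NumberField.maximalRealSubfield L)) L (NumberField.IsCMField.complexConj L) 3 V.Hm (UnitaryGroup.cmPlace (L : Type) ι₁)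
        (NumberField.complexConj_smul_infinitePlace (L : Type) _) (NumberField.IsCMField.complexConj_ne_one (L : Type)) a = 1 →
    ∀ ℓ, lineRepD V c.D (hGR V c) (hGR₀ V c) (hGR₁ V c) (hGR₂ V c) (hGR₃ V c) (EtaChi.η @χV (@SInstance.χWR @hGR @hGR₀ @hGR₁ @μ) V c) 0
        (HodgeCM.Adelic.regimeEquiv L V.Hm hV
          (UnitaryGroup.archToAdelic (↥(NumberField.maximalRealSubfield L)) L (NumberField.IsCMField.complexConj L) 3 V.Hm a), 1)
        (SupplyInstance.testFun (↥(NumberField.maximalRealSubfield L)) (Fin 3)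
          (blockFamilyOfAt (L : Type) e₁ (frameD V) (frameD_real V) (frameD_ne V) (lineVec (L : Type) (dW c.D 0))
            (fun _ => dW_real c.D 0) (fun _ => dW_ne c.D 0) ι₁ (blockPosEquiv V) (blockNegEquiv V)
            (posIdxEquivUnit (SInstance.hpos_GOG V c hG).1) (negIdxEquivEmpty (SInstance.hpos_GOG V c hG).1) (degOnePDual Empty) (Literature.Analysis.SegalBargmann.binvPi 1) ℓ)
          (((SInstance.AR @SInstance.GOG @SInstance.hG_GOG @hGR @χV @hGR₀ @hGR₁ @hGR₂ @hGR₃ @μ @SInstance.hpos_GOG @hΔ₁ @hΔ₂ @hΔ₃ V c hG) 0).x₀) N) =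
      SupplyInstance.testFun (↥(NumberField.maximalRealSubfield L)) (Fin 3)
        (blockFamilyOfAt (L : Type) e₁ (frameD V) (frameD_real V) (frameD_ne V) (lineVec (L : Type) (dW c.D 0))
          (fun _ => dW_real c.D 0) (fun _ => dW_ne c.D 0) ι₁ (blockPosEquiv V) (blockNegEquiv V)
          (posIdxEquivUnit (SInstance.hpos_GOG V c hG).1) (negIdxEquivEmpty (SInstance.hpos_GOG V c hG).1) (degOnePDual Empty) (Literature.Analysis.SegalBargmann.binvPi 1) ℓ)
        (((SInstance.AR @SInstance.GOG @SInstance.hG_GOG @hGR @χV @hGR₀ @hGR₁ @hGR₂ @hGR₃ @μ @SInstance.hpos_GOG @hΔ₁ @hΔ₂ @hΔ₃ V c hG) 0).x₀) N)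
    (hχ₀ : ∀ {L : CMField} {ι₁ : L →+* ℂ} (V : HermSpace3 L ι₁) (c : SeesawCtx L) (hG : SInstance.GOG V c), ∀ u : MulAction.stabilizer U21 x₀,
    ((lineScalar_zero V c.D (hGR V c) (hGR₀ V c) (hGR₁ V c) (eta₀ V c.D (EtaChi.η @χV (@SInstance.χWR @hGR @hGR₀ @hGR₁ @μ) V c)) (u : U21) : ℂˣ) : ℂ) *
        ((matA (stabilizerEquivK21.symm u)).det ^
            (lineVacExponentsZero V c (hGR₀ V c) (SInstance.hG_GOG V c hG) (posIdxEquivUnit (SInstance.hpos_GOG V c hG).1)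
              (negIdxEquivEmpty (SInstance.hpos_GOG V c hG).1)).eP *
          sclD (stabilizerEquivK21.symm u) ^
            (lineVacExponentsZero V c (hGR₀ V c) (SInstance.hG_GOG V c hG) (posIdxEquivUnit (SInstance.hpos_GOG V c hG).1)
              (negIdxEquivEmpty (SInstance.hpos_GOG V c hG).1)).eQ) =
      star (sclD (stabilizerEquivK21.symm u)))
    (harch₁ : ∀ {L : CMField} {ι₁ : L →+* ℂ} (V : HermSpace3 L ι₁) (c : SeesawCtx L) (hV : IsAnisotropic L V.Hm) (hG : SInstance.GOG V c) (N : ℕ), ∀ a : UnitaryGroup.arch (↥(NumberField.maximalRealSubfield L)) L (NumberField.IsCMField.complexConj L) 3 V.Hm,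
    UnitaryGroup.archAt (↥(NumberField.maximalRealSubfield L)) L (NumberField.IsCMField.complexConj L) 3 V.Hm (UnitaryGroup.cmPlace (L : Type) ι₁)
        (NumberField.complexConj_smul_infinitePlace (L : Type) _) (NumberField.IsCMField.complexConj_ne_one (L : Type)) a = 1 →
    ∀ ℓ, lineRepD V c.D (hGR V c) (hGR₀ V c) (hGR₁ V c) (hGR₂ V c) (hGR₃ V c) (EtaChi.η @χV (@SInstance.χWR @hGR @hGR₀ @hGR₁ @μ) V c) 1
        (HodgeCM.Adelic.regimeEquiv L V.Hm hV
          (UnitaryGroup.archToAdelic (↥(NumberField.maximalRealSubfield L)) L (NumberField.IsCMField.complexConj L) 3 V.Hm a), 1)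
        (SupplyInstance.testFun (↥(NumberField.maximalRealSubfield L)) (Fin 3)
          (blockFamilyOfAt (L : Type) e₁ (frameD V) (frameD_real V) (frameD_ne V) (lineVec (L : Type) (dW c.D 1))
            (fun _ => dW_real c.D 1) (fun _ => dW_ne c.D 1) ι₁ (blockPosEquiv V) (blockNegEquiv V)
            (posIdxEquivUnit (SInstance.hpos_GOG V c hG).2.1) (negIdxEquivEmpty (SInstance.hpos_GOG V c hG).2.1) (degOnePDual Empty) (Literature.Analysis.SegalBargmann.binvPi 1) ℓ)
          (((SInstance.AR @SInstance.GOG @SInstance.hG_GOG @hGR @χV @hGR₀ @hGR₁ @hGR₂ @hGR₃ @μ @SInstance.hpos_GOG @hΔ₁ @hΔ₂ @hΔ₃ V c hG) 1).x₀) N) =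
      SupplyInstance.testFun (↥(NumberField.maximalRealSubfield L)) (Fin 3)
        (blockFamilyOfAt (L : Type) e₁ (frameD V) (frameD_real V) (frameD_ne V) (lineVec (L : Type) (dW c.D 1))
          (fun _ => dW_real c.D 1) (fun _ => dW_ne c.D 1) ι₁ (blockPosEquiv V) (blockNegEquiv V)
          (posIdxEquivUnit (SInstance.hpos_GOG V c hG).2.1) (negIdxEquivEmpty (SInstance.hpos_GOG V c hG).2.1) (degOnePDual Empty) (Literature.Analysis.SegalBargmann.binvPi 1) ℓ)
        (((SInstance.AR @SInstance.GOG @SInstance.hG_GOG @hGR @χV @hGR₀ @hGR₁ @hGR₂ @hGR₃ @μ @SInstance.hpos_GOG @hΔ₁ @hΔ₂ @hΔ₃ V c hG) 1).x₀) N)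
    (hχ₁ : ∀ {L : CMField} {ι₁ : L →+* ℂ} (V : HermSpace3 L ι₁) (c : SeesawCtx L) (hG : SInstance.GOG V c), ∀ u : MulAction.stabilizer U21 x₀,
    ((lineScalar_one V c.D (hGR V c) (hGR₀ V c) (hGR₁ V c) (eta₁ V c.D (EtaChi.η @χV (@SInstance.χWR @hGR @hGR₀ @hGR₁ @μ) V c)) (u : U21) : ℂˣ) : ℂ) *
        ((matA (stabilizerEquivK21.symm u)).det ^
            (lineVacExponentsOne V c (hGR₁ V c) (SInstance.hG_GOG V c hG) (posIdxEquivUnit (SInstance.hpos_GOG V c hG).2.1)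
              (negIdxEquivEmpty (SInstance.hpos_GOG V c hG).2.1)).eP *
          sclD (stabilizerEquivK21.symm u) ^
            (lineVacExponentsOne V c (hGR₁ V c) (SInstance.hG_GOG V c hG) (posIdxEquivUnit (SInstance.hpos_GOG V c hG).2.1)
              (negIdxEquivEmpty (SInstance.hpos_GOG V c hG).2.1)).eQ) =
      star (sclD (stabilizerEquivK21.symm u)))
    (gen12 : ∀ {L : CMField} {ι₁ : L →+* ℂ} (V : HermSpace3 L ι₁) (c : SeesawCtx L),
      (thetaModelOf hHD hI h₁ (cmAbelianVarietyRealised_of_eigenbasis hHD hI h₃) (orientBitι L ι₁) (embOf hHD hI h₁ (cmAbelianVarietyRealised_of_eigenbasis hHD hI h₃)) (coverOf hHD hI h₁ (cmAbelianVarietyRealised_of_eigenbasis hHD hI h₃) hA) (wmOfInput W) (thetaOf _ (thetaClassInputOf _ (fun V c => thetaSpaceInputOf hHD hI h₁ (cmAbelianVarietyRealised_of_eigenbasis hHD hI h₃) (SInstance.SROG @hGR @χV @hGR₀ @hGR₁ @hGR₂ @hGR₃ @μ hΔ₁ hΔ₂ hΔ₃) V c))) (d12Of μ) (d34Of μ)).GoodCtx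 ι₁ c → Module.finrank ℚ c.K = 6 ∧ IsNormalClosure ℚ c.K L ∧ (Module.finrank ℚ L = 24 ∨ Module.finrank ℚ L = 48) →
      (NumberField.InfinitePlace.mk ι₁).embedding = ι₁ →
      Nonempty ((thetaModelOf hHD hI h₁ (cmAbelianVarietyRealised_of_eigenbasis hHD hI h₃) (orientBitι L ι₁) (embOf hHD hI h₁ (cmAbelianVarietyRealised_of_eigenbasis hHD hI h₃)) (coverOf hHD hI h₁ (cmAbelianVarietyRealised_of_eigenbasis hHD hI h₃) hA) (wmOfInput W) (thetaOf _ (thetaClassInputOf _ (fun V c => thetaSpaceInputOf hHD hI h₁ (cmAbelianVarietyRealised_of_eigenbasis hHD hI h₃) (SInstance.SROG @hGR @χV @hGR₀ @hGR₁ @hGR₂ @hGR₃ @μ hΔ₁ hΔ₂ hΔ₃) V c))) (d12Of μ) (d34Of μ)).Gen12FunBridge V c))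
    (real34 : ∀ {L : CMField} {ι₁ : L →+* ℂ} (V : HermSpace3 L ι₁) (c : SeesawCtx L),
      (thetaModelOf hHD hI h₁ (cmAbelianVarietyRealised_of_eigenbasis hHD hI h₃) (orientBitι L ι₁) (embOf hHD hI h₁ (cmAbelianVarietyRealised_of_eigenbasis hHD hI h₃)) (coverOf hHD hI h₁ (cmAbelianVarietyRealised_of_eigenbasis hHD hI h₃) hA) (wmOfInput W) (thetaOf _ (thetaClassInputOf _ (fun V c => thetaSpaceInputOf hHD hI h₁ (cmAbelianVarietyRealised_of_eigenbasis hHD hI h₃) (SInstance.SROG @hGR @χV @hGR₀ @hGR₁ @hGR₂ @hGR₃ @μ hΔ₁ hΔ₂ hΔ₃) V c))) (d12Of μ) (d34Of μ)).GoodCtx ι₁ c → Module.finrank ℚ c.K = 6 ∧ IsNormalClosure ℚ c.K L ∧ (Module.finrank ℚ L = 24 ∨ Module.finrank ℚ L = 48) →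
      (NumberField.InfinitePlace.mk ι₁).embedding = ι₁ →
      Nonempty ((thetaModelOf hHD hI h₁ (cmAbelianVarietyRealised_of_eigenbasis hHD hI h₃) (orientBitι L ι₁) (embOf hHD hI h₁ (cmAbelianVarietyRealised_of_eigenbasis hHD hI h₃)) (coverOf hHD hI h₁ (cmAbelianVarietyRealised_of_eigenbasis hHD hI h₃) hA) (wmOfInput W) (thetaOf _ (thetaClassInputOf _ (fun V c => thetaSpaceInputOf hHD hI h₁ (cmAbelianVarietyRealised_of_eigenbasis hHD hI h₃) (SInstance.SROG @hGR @χV @hGR₀ @hGR₁ @hGR₂ @hGR₃ @μ hΔ₁ hΔ₂ hΔ₃) V c))) (d12Of μ) (d34Of μ)).Real34FunBridge V c))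
    (hyp12 : ∀ {L : CMField} {ι₁ : L →+* ℂ} (V : HermSpace3 L ι₁) (c : SeesawCtx L),
      (thetaModelOf hHD hI h₁ (cmAbelianVarietyRealised_of_eigenbasis hHD hI h₃) (orientBitι L ι₁) (embOf hHD hI h₁ (cmAbelianVarietyRealised_of_eigenbasis hHD hI h₃)) (coverOf hHD hI h₁ (cmAbelianVarietyRealised_of_eigenbasis hHD hI h₃) hA) (wmOfInput W) (thetaOf _ (thetaClassInputOf _ (fun V c => thetaSpaceInputOf hHD hI h₁ (cmAbelianVarietyRealised_of_eigenbasis hHD hI h₃) (SInstance.SROG @hGR @χV @hGR₀ @hGR₁ @hGR₂ @hGR₃ @μ hΔ₁ hΔ₂ hΔ₃) V c))) (d12Of μ) (d34Of μ)).GoodCtx ι₁ c → Module.finrank ℚ c.K = 6 ∧ IsNormalClosure ℚ c.K L ∧ (Module.finrank ℚ L = 24 ∨ Module.finrank ℚ L = 48) →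
      (NumberField.InfinitePlace.mk ι₁).embedding = ι₁ →
      Nonempty (((coreOf _ (embOf hHD hI h₁ (cmAbelianVarietyRealised_of_eigenbasis hHD hI h₃)) (coverOf hHD hI h₁ (cmAbelianVarietyRealised_of_eigenbasis hHD hI h₃) hA) (wmOfInput W) (thetaOf _ (thetaClassInputOf _ (fun V c => thetaSpaceInputOf hHD hI h₁ (cmAbelianVarietyRealised_of_eigenbasis hHD hI h₃) (SInstance.SROG @hGR @χV @hGR₀ @hGR₁ @hGR₂ @hGR₃ @μ hΔ₁ hΔ₂ hΔ₃) V c)))).toCore (orientBitι L ι₁)).HypSmoothCore12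
        (((coreOf _ (embOf hHD hI h₁ (cmAbelianVarietyRealised_of_eigenbasis hHD hI h₃)) (coverOf hHD hI h₁ (cmAbelianVarietyRealised_of_eigenbasis hHD hI h₃) hA) (wmOfInput W) (thetaOf _ (thetaClassInputOf _ (fun V c => thetaSpaceInputOf hHD hI h₁ (cmAbelianVarietyRealised_of_eigenbasis hHD hI h₃) (SInstance.SROG @hGR @χV @hGR₀ @hGR₁ @hGR₂ @hGR₃ @μ hΔ₁ hΔ₂ hΔ₃) V c)))).toCore (orientBitι L ι₁)).side12 (d12Of μ)) (((coreOf _ (embOf hHD hI h₁ (cmAbelianVarietyRealised_of_eigenbasis hHD hI h₃)) (coverOf hHD hI h₁ (cmAbelianVarietyRealised_of_eigenbasis hHD hI h₃) hA) (wmOfInput W) (thetaOf _ (thetaClassInputOf _ (fun V c => thetaSpaceInputOf hHD hI h₁ (cmAbelianVarietyRealised_of_eigenbasis hHD hI h₃) (SInstance.SROG @hGR @χV @hGR₀ @hGR₁ @hGR₂ @hGR₃ @μ hΔ₁ hΔ₂ hΔ₃) V c)))).toCore (orientBitι L ι₁)).side34 (d34Of μ))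
        ((((coreOf _ (embOf hHD hI h₁ (cmAbelianVarietyRealised_of_eigenbasis hHD hI h₃)) (coverOf hHD hI h₁ (cmAbelianVarietyRealised_of_eigenbasis hHD hI h₃) hA) (wmOfInput W) (thetaOf _ (thetaClassInputOf _ (fun V c => thetaSpaceInputOf hHD hI h₁ (cmAbelianVarietyRealised_of_eigenbasis hHD hI h₃) (SInstance.SROG @hGR @χV @hGR₀ @hGR₁ @hGR₂ @hGR₃ @μ hΔ₁ hΔ₂ hΔ₃) V c)))).toCore (orientBitι L ι₁)).analyticKM (((coreOf _ (embOf hHD hI h₁ (cmAbelianVarietyRealised_of_eigenbasis hHD hI h₃)) (coverOf hHD hI h₁ (cmAbelianVarietyRealised_of_eigenbasis hHD hI h₃) hA) (wmOfInput W) (thetaOf _ (thetaClassInputOf _ (fun V c => thetaSpaceInputOf hHD hI h₁ (cmAbelianVarietyRealised_of_eigenbasis hHD hI h₃) (SInstance.SROG @hGR @χV @hGR₀ @hGR₁ @hGR₂ @hGR₃ @μ hΔ₁ hΔ₂ hΔ₃) V c)))).toCore (orientBitι L ι₁)).side12 (d12Of μ))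
          (((coreOf _ (embOf hHD hI h₁ (cmAbelianVarietyRealised_of_eigenbasis hHD hI h₃)) (coverOf hHD hI h₁ (cmAbelianVarietyRealised_of_eigenbasis hHD hI h₃) hA) (wmOfInput W) (thetaOf _ (thetaClassInputOf _ (fun V c => thetaSpaceInputOf hHD hI h₁ (cmAbelianVarietyRealised_of_eigenbasis hHD hI h₃) (SInstance.SROG @hGR @χV @hGR₀ @hGR₁ @hGR₂ @hGR₃ @μ hΔ₁ hΔ₂ hΔ₃) V c)))).toCore (orientBitι L ι₁)).side34 (d34Of μ))).toAnalytic) V c (ℓ := linOfInput W V c)))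
    (hyp34 : ∀ {L : CMField} {ι₁ : L →+* ℂ} (V : HermSpace3 L ι₁) (c : SeesawCtx L),
      (thetaModelOf hHD hI h₁ (cmAbelianVarietyRealised_of_eigenbasis hHD hI h₃) (orientBitι L ι₁) (embOf hHD hI h₁ (cmAbelianVarietyRealised_of_eigenbasis hHD hI h₃)) (coverOf hHD hI h₁ (cmAbelianVarietyRealised_of_eigenbasis hHD hI h₃) hA) (wmOfInput W) (thetaOf _ (thetaClassInputOf _ (fun V c => thetaSpaceInputOf hHD hI h₁ (cmAbelianVarietyRealised_of_eigenbasis hHD hI h₃) (SInstance.SROG @hGR @χV @hGR₀ @hGR₁ @hGR₂ @hGR₃ @μ hΔ₁ hΔ₂ hΔ₃) V c))) (d12Of μ) (d34Of μ)).GoodCtx ι₁ c → Module.finrank ℚ c.K = 6 ∧ IsNormalClosure ℚ c.K L ∧ (Module.finrank ℚ L = 24 ∨ Module.finrank ℚ L = 48) →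
      (NumberField.InfinitePlace.mk ι₁).embedding = ι₁ →
      Nonempty (((coreOf _ (embOf hHD hI h₁ (cmAbelianVarietyRealised_of_eigenbasis hHD hI h₃)) (coverOf hHD hI h₁ (cmAbelianVarietyRealised_of_eigenbasis hHD hI h₃) hA) (wmOfInput W) (thetaOf _ (thetaClassInputOf _ (fun V c => thetaSpaceInputOf hHD hI h₁ (cmAbelianVarietyRealised_of_eigenbasis hHD hI h₃) (SInstance.SROG @hGR @χV @hGR₀ @hGR₁ @hGR₂ @hGR₃ @μ hΔ₁ hΔ₂ hΔ₃) V c)))).toCore (orientBitι L ι₁)).HypSmoothCore34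
        (((coreOf _ (embOf hHD hI h₁ (cmAbelianVarietyRealised_of_eigenbasis hHD hI h₃)) (coverOf hHD hI h₁ (cmAbelianVarietyRealised_of_eigenbasis hHD hI h₃) hA) (wmOfInput W) (thetaOf _ (thetaClassInputOf _ (fun V c => thetaSpaceInputOf hHD hI h₁ (cmAbelianVarietyRealised_of_eigenbasis hHD hI h₃) (SInstance.SROG @hGR @χV @hGR₀ @hGR₁ @hGR₂ @hGR₃ @μ hΔ₁ hΔ₂ hΔ₃) V c)))).toCore (orientBitι L ι₁)).side12 (d12Of μ)) (((coreOf _ (embOf hHD hI h₁ (cmAbelianVarietyRealised_of_eigenbasis hHD hI h₃)) (coverOf hHD hI h₁ (cmAbelianVarietyRealised_of_eigenbasis hHD hI h₃) hA) (wmOfInput W) (thetaOf _ (thetaClassInputOf _ (fun V c => thetaSpaceInputOf hHD hI h₁ (cmAbelianVarietyRealised_of_eigenbasis hHD hI h₃) (SInstance.SROG @hGR @χV @hGR₀ @hGR₁ @hGR₂ @hGR₃ @μ hΔ₁ hΔ₂ hΔ₃) V c)))).toCore (orientBitι L ι₁)).side34 (d34Of μ))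
        ((((coreOf _ (embOf hHD hI h₁ (cmAbelianVarietyRealised_of_eigenbasis hHD hI h₃)) (coverOf hHD hI h₁ (cmAbelianVarietyRealised_of_eigenbasis hHD hI h₃) hA) (wmOfInput W) (thetaOf _ (thetaClassInputOf _ (fun V c => thetaSpaceInputOf hHD hI h₁ (cmAbelianVarietyRealised_of_eigenbasis hHD hI h₃) (SInstance.SROG @hGR @χV @hGR₀ @hGR₁ @hGR₂ @hGR₃ @μ hΔ₁ hΔ₂ hΔ₃) V c)))).toCore (orientBitι L ι₁)).analyticKM (((coreOf _ (embOf hHD hI h₁ (cmAbelianVarietyRealised_of_eigenbasis hHD hI h₃)) (coverOf hHD hI h₁ (cmAbelianVarietyRealised_of_eigenbasis hHD hI h₃) hA) (wmOfInput W) (thetaOf _ (thetaClassInputOf _ (fun V c => thetaSpaceInputOf hHD hI h₁ (cmAbelianVarietyRealised_of_eigenbasis hHD hI h₃) (SInstance.SROG @hGR @χV @hGR₀ @hGR₁ @hGR₂ @hGR₃ @μ hΔ₁ hΔ₂ hΔ₃) V c)))).toCore (orientBitι L ι₁)).side12 (d12Of μ))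
          (((coreOf _ (embOf hHD hI h₁ (cmAbelianVarietyRealised_of_eigenbasis hHD hI h₃)) (coverOf hHD hI h₁ (cmAbelianVarietyRealised_of_eigenbasis hHD hI h₃) hA) (wmOfInput W) (thetaOf _ (thetaClassInputOf _ (fun V c => thetaSpaceInputOf hHD hI h₁ (cmAbelianVarietyRealised_of_eigenbasis hHD hI h₃) (SInstance.SROG @hGR @χV @hGR₀ @hGR₁ @hGR₂ @hGR₃ @μ hΔ₁ hΔ₂ hΔ₃) V c)))).toCore (orientBitι L ι₁)).side34 (d34Of μ))).toAnalytic) V c (ℓ := linOfInput W V c))) :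
     (picardCMUniverse hHD hI h₁ (cmAbelianVarietyRealised_of_eigenbasis hHD hI h₃)).PerL :=
  perL_picardCM_r21AEOGIS hHD hI h₁ h₃ hA W hGR χV hGR₀ hGR₁ hGR₂ hGR₃ μ hΔ₁ hΔ₂ hΔ₃ hR hΘ
    (fun {L} {ι₁} V c hV hc _h6 hcan k hk N _hN =>
      (fun hG : SInstance.GOG V c =>
        archKTypeOfSide hHD hI h₁ (cmAbelianVarietyRealised_of_eigenbasis hHD hI h₃) V c ((SInstance.SROG @hGR @χV @hGR₀ @hGR₁ @hGR₂ @hGR₃ @μ hΔ₁ hΔ₂ hΔ₃) V c) (hGR V c) (hGR₀ V c) (hGR₁ V c) (hGR₂ V c) (hGR₃ V c) (EtaChi.η @χV (@SInstance.χWR @hGR @hGR₀ @hGR₁ @μ) V c) (EtaChi.hη @χV (@SInstance.χWR @hGR @hGR₀ @hGR₁ @μ) V c) (EtaChi.hηc @χV (@SInstance.χWR @hGR @hGR₀ @hGR₁ @μ) V c) (SInstance.hG_GOG V c hG)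
          (SInstance.AR @SInstance.GOG @SInstance.hG_GOG @hGR @χV @hGR₀ @hGR₁ @hGR₂ @hGR₃ @μ @SInstance.hpos_GOG @hΔ₁ @hΔ₂ @hΔ₃ V c hG)
          (SInstance.SR_eq_archSideOf @SInstance.GOG @SInstance.hG_GOG @hGR @χV @hGR₀ @hGR₁ @hGR₂ @hGR₃ @μ @SInstance.hpos_GOG @hΔ₁ @hΔ₂ @hΔ₃ V c hG) hV hcan (SInstance.hpos_GOG V c hG).1 (SInstance.hpos_GOG V c hG).2.1 N
          (deepLevel V ((deepIndexZero V c.D (hGR V c) (hGR₀ V c) (hGR₁ V c) (EtaChi.η @χV (@SInstance.χWR @hGR @hGR₀ @hGR₁ @μ) V c) (EtaChi.hηc @χV (@SInstance.χWR @hGR @hGR₀ @hGR₁ @μ) V c) (SInstance.hG_GOG V c hG) ((SInstance.AR @SInstance.GOG @SInstance.hG_GOG @hGR @χV @hGR₀ @hGR₁ @hGR₂ @hGR₃ @μ @SInstance.hpos_GOG @hΔ₁ @hΔ₂ @hΔ₃ V c hG) 0).x₀ N) * (deepIndexOne V c.D (hGR V c) (hGR₀ V c) (hGR₁ V c) (EtaChi.η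 @χV (@SInstance.χWR @hGR @hGR₀ @hGR₁ @μ) V c) (EtaChi.hηc @χV (@SInstance.χWR @hGR @hGR₀ @hGR₁ @μ) V c) ((SInstance.AR @SInstance.GOG @SInstance.hG_GOG @hGR @χV @hGR₀ @hGR₁ @hGR₂ @hGR₃ @μ @SInstance.hpos_GOG @hΔ₁ @hΔ₂ @hΔ₃ V c hG) 1).x₀ N)) (mul_ne_zero (deepIndexZero_ne_zero V c.D (hGR V c) (hGR₀ V c) (hGR₁ V c) (EtaChi.η @χV (@SInstance.χWR @hGR @hGR₀ @hGR₁ @μ) V c) (EtaChi.hηc @χV (@SInstance.χWR @hGR @hGR₀ @hGR₁ @μ) V c) (SInstance.hG_GOG V c hG) ((SInstance.AR @SInstance.GOG @SInstance.hG_GOG @hGR @χV @hGR₀ @hGR₁ @hGR₂ @hGR₃ @μ @SInstance.hpos_GOG @hΔ₁ @hΔ₂ @hΔ₃ V c hG) 0).x₀ N) (deepIndexOne_ne_zero V c.D (hGR V c) (hGR₀ V c) (hGR₁ V c) (EtaChi.η @χV (@SInstance.χWR @hGR @hGR₀ @hGR₁ @μ) V c) (EtaChi.hηc @χV (@SInstance.χWR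 @hGR @hGR₀ @hGR₁ @μ) V c) ((SInstance.AR @SInstance.GOG @SInstance.hG_GOG @hGR @χV @hGR₀ @hGR₁ @hGR₂ @hGR₃ @μ @SInstance.hpos_GOG @hΔ₁ @hΔ₂ @hΔ₃ V c hG) 1).x₀ N)))
          rfl (harch₀ V c hV hG N)
          (hfin_zero_deepLevel V c.D (hGR V c) (hGR₀ V c) (hGR₁ V c) (hGR₂ V c) (hGR₃ V c) (EtaChi.η @χV (@SInstance.χWR @hGR @hGR₀ @hGR₁ @μ) V c) hV (EtaChi.hηc @χV (@SInstance.χWR @hGR @hGR₀ @hGR₁ @μ) V c) (SInstance.hG_GOG V c hG) ((SInstance.AR @SInstance.GOG @SInstance.hG_GOG @hGR @χV @hGR₀ @hGR₁ @hGR₂ @hGR₃ @μ @SInstance.hpos_GOG @hΔ₁ @hΔ₂ @hΔ₃ V c hG) 0).x₀ N (mul_ne_zero (deepIndexZero_ne_zero V c.D (hGR V c) (hGR₀ V c) (hGR₁ V c) (EtaChi.η @χV (@SInstance.χWR @hGR @hGR₀ @hGR₁ @μ) V c) (EtaChi.hηc @χV (@SInstance.χWR @hGR @hGR₀ @hGR₁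 @μ) V c) (SInstance.hG_GOG V c hG) ((SInstance.AR @SInstance.GOG @SInstance.hG_GOG @hGR @χV @hGR₀ @hGR₁ @hGR₂ @hGR₃ @μ @SInstance.hpos_GOG @hΔ₁ @hΔ₂ @hΔ₃ V c hG) 0).x₀ N) (deepIndexOne_ne_zero V c.D (hGR V c) (hGR₀ V c) (hGR₁ V c) (EtaChi.η @χV (@SInstance.χWR @hGR @hGR₀ @hGR₁ @μ) V c) (EtaChi.hηc @χV (@SInstance.χWR @hGR @hGR₀ @hGR₁ @μ) V c) ((SInstance.AR @SInstance.GOG @SInstance.hG_GOG @hGR @χV @hGR₀ @hGR₁ @hGR₂ @hGR₃ @μ @SInstance.hpos_GOG @hΔ₁ @hΔ₂ @hΔ₃ V c hG) 1).x₀ N)) (dvd_mul_right _ _))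
          (hχ₀ V c hG) rfl (harch₁ V c hV hG N)
          (hfin_one_deepLevel V c.D (hGR V c) (hGR₀ V c) (hGR₁ V c) (hGR₂ V c) (hGR₃ V c) (EtaChi.η @χV (@SInstance.χWR @hGR @hGR₀ @hGR₁ @μ) V c) hV (EtaChi.hηc @χV (@SInstance.χWR @hGR @hGR₀ @hGR₁ @μ) V c) ((SInstance.AR @SInstance.GOG @SInstance.hG_GOG @hGR @χV @hGR₀ @hGR₁ @hGR₂ @hGR₃ @μ @SInstance.hpos_GOG @hΔ₁ @hΔ₂ @hΔ₃ V c hG) 1).x₀ N (mul_ne_zero (deepIndexZero_ne_zero V c.D (hGR V c) (hGR₀ V c) (hGR₁ V c) (EtaChi.η @χV (@SInstance.χWR @hGR @hGR₀ @hGR₁ @μ) V c) (EtaChi.hηc @χV (@SInstance.χWR @hGR @hGR₀ @hGR₁ @μ) V c) (SInstance.hG_GOG V c hG) ((SInstance.AR @SInstance.GOG @SInstance.hG_GOG @hGR @χV @hGR₀ @hGR₁ @hGR₂ @hGR₃ @μ @SInstance.hpos_GOG @hΔ₁ @hΔ₂ @hΔ₃ V c hG) 0).x₀ N) (deepIndexOne_ne_zero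 V c.D (hGR V c) (hGR₀ V c) (hGR₁ V c) (EtaChi.η @χV (@SInstance.χWR @hGR @hGR₀ @hGR₁ @μ) V c) (EtaChi.hηc @χV (@SInstance.χWR @hGR @hGR₀ @hGR₁ @μ) V c) ((SInstance.AR @SInstance.GOG @SInstance.hG_GOG @hGR @χV @hGR₀ @hGR₁ @hGR₂ @hGR₃ @μ @SInstance.hpos_GOG @hΔ₁ @hΔ₂ @hΔ₃ V c hG) 1).x₀ N)) (dvd_mul_left _ _))
          (hχ₁ V c hG) k hk)
        ⟨hcan, (HodgeCM.Universe.AdelicThetaCore.thetaModel_goodCtx_iff _ (orientBitι L ι₁) (d12Of μ) (d34Of μ) ι₁ c).mp hc⟩)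
    (fun {L} {ι₁} V c hV hc _h6 hcan k hk N _hN =>
      (fun hG : SInstance.GOG V c =>
        isWeaklyPDiff_archKTypeOfSide hHD hI h₁ (cmAbelianVarietyRealised_of_eigenbasis hHD hI h₃) V c ((SInstance.SROG @hGR @χV @hGR₀ @hGR₁ @hGR₂ @hGR₃ @μ hΔ₁ hΔ₂ hΔ₃) V c) (hGR V c) (hGR₀ V c) (hGR₁ V c) (hGR₂ V c) (hGR₃ V c) (EtaChi.η @χV (@SInstance.χWR @hGR @hGR₀ @hGR₁ @μ) V c) (EtaChi.hη @χV (@SInstance.χWR @hGR @hGR₀ @hGR₁ @μ) V c) (EtaChi.hηc @χV (@SInstance.χWR @hGR @hGR₀ @hGR₁ @μ) V c) (SInstance.hG_GOG V c hG)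
          (SInstance.AR @SInstance.GOG @SInstance.hG_GOG @hGR @χV @hGR₀ @hGR₁ @hGR₂ @hGR₃ @μ @SInstance.hpos_GOG @hΔ₁ @hΔ₂ @hΔ₃ V c hG)
          (SInstance.SR_eq_archSideOf @SInstance.GOG @SInstance.hG_GOG @hGR @χV @hGR₀ @hGR₁ @hGR₂ @hGR₃ @μ @SInstance.hpos_GOG @hΔ₁ @hΔ₂ @hΔ₃ V c hG) hV hcan (SInstance.hpos_GOG V c hG).1 (SInstance.hpos_GOG V c hG).2.1 N
          (deepLevel V ((deepIndexZero V c.D (hGR V c) (hGR₀ V c) (hGR₁ V c) (EtaChi.η @χV (@SInstance.χWR @hGR @hGR₀ @hGR₁ @μ) V c) (EtaChi.hηc @χV (@SInstance.χWR @hGR @hGR₀ @hGR₁ @μ) V c) (SInstance.hG_GOG V c hG) ((SInstance.AR @SInstance.GOG @SInstance.hG_GOG @hGR @χV @hGR₀ @hGR₁ @hGR₂ @hGR₃ @μ @SInstance.hpos_GOG @hΔ₁ @hΔ₂ @hΔ₃ V c hG) 0).x₀ N) * (deepIndexOne V c.D (hGR V c) (hGR₀ V c) (hGR₁ V c) (EtaChi.η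 @χV (@SInstance.χWR @hGR @hGR₀ @hGR₁ @μ) V c) (EtaChi.hηc @χV (@SInstance.χWR @hGR @hGR₀ @hGR₁ @μ) V c) ((SInstance.AR @SInstance.GOG @SInstance.hG_GOG @hGR @χV @hGR₀ @hGR₁ @hGR₂ @hGR₃ @μ @SInstance.hpos_GOG @hΔ₁ @hΔ₂ @hΔ₃ V c hG) 1).x₀ N)) (mul_ne_zero (deepIndexZero_ne_zero V c.D (hGR V c) (hGR₀ V c) (hGR₁ V c) (EtaChi.η @χV (@SInstance.χWR @hGR @hGR₀ @hGR₁ @μ) V c) (EtaChi.hηc @χV (@SInstance.χWR @hGR @hGR₀ @hGR₁ @μ) V c) (SInstance.hG_GOG V c hG) ((SInstance.AR @SInstance.GOG @SInstance.hG_GOG @hGR @χV @hGR₀ @hGR₁ @hGR₂ @hGR₃ @μ @SInstance.hpos_GOG @hΔ₁ @hΔ₂ @hΔ₃ V c hG) 0).x₀ N) (deepIndexOne_ne_zero V c.D (hGR V c) (hGR₀ V c) (hGR₁ V c) (EtaChi.η @χV (@SInstance.χWR @hGR @hGR₀ @hGR₁ @μ) V c) (EtaChi.hηc @χV (@SInstance.χWR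 @hGR @hGR₀ @hGR₁ @μ) V c) ((SInstance.AR @SInstance.GOG @SInstance.hG_GOG @hGR @χV @hGR₀ @hGR₁ @hGR₂ @hGR₃ @μ @SInstance.hpos_GOG @hΔ₁ @hΔ₂ @hΔ₃ V c hG) 1).x₀ N)))
          rfl (harch₀ V c hV hG N)
          (hfin_zero_deepLevel V c.D (hGR V c) (hGR₀ V c) (hGR₁ V c) (hGR₂ V c) (hGR₃ V c) (EtaChi.η @χV (@SInstance.χWR @hGR @hGR₀ @hGR₁ @μ) V c) hV (EtaChi.hηc @χV (@SInstance.χWR @hGR @hGR₀ @hGR₁ @μ) V c) (SInstance.hG_GOG V c hG) ((SInstance.AR @SInstance.GOG @SInstance.hG_GOG @hGR @χV @hGR₀ @hGR₁ @hGR₂ @hGR₃ @μ @SInstance.hpos_GOG @hΔ₁ @hΔ₂ @hΔ₃ V c hG) 0).x₀ N (mul_ne_zero (deepIndexZero_ne_zero V c.D (hGR V c) (hGR₀ V c) (hGR₁ V c) (EtaChi.η @χV (@SInstance.χWR @hGR @hGR₀ @hGR₁ @μ) V c) (EtaChi.hηc @χV (@SInstance.χWR @hGR @hGR₀ @hGR₁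 @μ) V c) (SInstance.hG_GOG V c hG) ((SInstance.AR @SInstance.GOG @SInstance.hG_GOG @hGR @χV @hGR₀ @hGR₁ @hGR₂ @hGR₃ @μ @SInstance.hpos_GOG @hΔ₁ @hΔ₂ @hΔ₃ V c hG) 0).x₀ N) (deepIndexOne_ne_zero V c.D (hGR V c) (hGR₀ V c) (hGR₁ V c) (EtaChi.η @χV (@SInstance.χWR @hGR @hGR₀ @hGR₁ @μ) V c) (EtaChi.hηc @χV (@SInstance.χWR @hGR @hGR₀ @hGR₁ @μ) V c) ((SInstance.AR @SInstance.GOG @SInstance.hG_GOG @hGR @χV @hGR₀ @hGR₁ @hGR₂ @hGR₃ @μ @SInstance.hpos_GOG @hΔ₁ @hΔ₂ @hΔ₃ V c hG) 1).x₀ N)) (dvd_mul_right _ _))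
          (hχ₀ V c hG) rfl (harch₁ V c hV hG N)
          (hfin_one_deepLevel V c.D (hGR V c) (hGR₀ V c) (hGR₁ V c) (hGR₂ V c) (hGR₃ V c) (EtaChi.η @χV (@SInstance.χWR @hGR @hGR₀ @hGR₁ @μ) V c) hV (EtaChi.hηc @χV (@SInstance.χWR @hGR @hGR₀ @hGR₁ @μ) V c) ((SInstance.AR @SInstance.GOG @SInstance.hG_GOG @hGR @χV @hGR₀ @hGR₁ @hGR₂ @hGR₃ @μ @SInstance.hpos_GOG @hΔ₁ @hΔ₂ @hΔ₃ V c hG) 1).x₀ N (mul_ne_zero (deepIndexZero_ne_zero V c.D (hGR V c) (hGR₀ V c) (hGR₁ V c) (EtaChi.η @χV (@SInstance.χWR @hGR @hGR₀ @hGR₁ @μ) V c) (EtaChi.hηc @χV (@SInstance.χWR @hGR @hGR₀ @hGR₁ @μ) V c) (SInstance.hG_GOG V c hG) ((SInstance.AR @SInstance.GOG @SInstance.hG_GOG @hGR @χV @hGR₀ @hGR₁ @hGR₂ @hGR₃ @μ @SInstance.hpos_GOG @hΔ₁ @hΔ₂ @hΔ₃ V c hG) 0).x₀ N) (deepIndexOne_ne_zero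 V c.D (hGR V c) (hGR₀ V c) (hGR₁ V c) (EtaChi.η @χV (@SInstance.χWR @hGR @hGR₀ @hGR₁ @μ) V c) (EtaChi.hηc @χV (@SInstance.χWR @hGR @hGR₀ @hGR₁ @μ) V c) ((SInstance.AR @SInstance.GOG @SInstance.hG_GOG @hGR @χV @hGR₀ @hGR₁ @hGR₂ @hGR₃ @μ @SInstance.hpos_GOG @hΔ₁ @hΔ₂ @hΔ₃ V c hG) 1).x₀ N)) (dvd_mul_left _ _))
          (hχ₁ V c hG) k hk)
        ⟨hcan, (HodgeCM.Universe.AdelicThetaCore.thetaModel_goodCtx_iff _ (orientBitι L ι₁) (d12Of μ) (d34Of μ) ι₁ c).mp hc⟩)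
    (fun {L} {ι₁} V c hV hc _h6 hcan k hk N _hN p =>
      (fun hG : SInstance.GOG V c =>
        isPMinusKilledAlong_archKTypeOfSide hHD hI h₁ (cmAbelianVarietyRealised_of_eigenbasis hHD hI h₃) V c ((SInstance.SROG @hGR @χV @hGR₀ @hGR₁ @hGR₂ @hGR₃ @μ hΔ₁ hΔ₂ hΔ₃) V c) (hGR V c) (hGR₀ V c) (hGR₁ V c) (hGR₂ V c) (hGR₃ V c) (EtaChi.η @χV (@SInstance.χWR @hGR @hGR₀ @hGR₁ @μ) V c) (EtaChi.hη @χV (@SInstance.χWR @hGR @hGR₀ @hGR₁ @μ) V c) (EtaChi.hηc @χV (@SInstance.χWR @hGR @hGR₀ @hGR₁ @μ) V c) (SInstance.hG_GOG V c hG)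
          (SInstance.AR @SInstance.GOG @SInstance.hG_GOG @hGR @χV @hGR₀ @hGR₁ @hGR₂ @hGR₃ @μ @SInstance.hpos_GOG @hΔ₁ @hΔ₂ @hΔ₃ V c hG)
          (SInstance.SR_eq_archSideOf @SInstance.GOG @SInstance.hG_GOG @hGR @χV @hGR₀ @hGR₁ @hGR₂ @hGR₃ @μ @SInstance.hpos_GOG @hΔ₁ @hΔ₂ @hΔ₃ V c hG) hV hcan (SInstance.hpos_GOG V c hG).1 (SInstance.hpos_GOG V c hG).2.1 N
          (deepLevel V ((deepIndexZero V c.D (hGR V c) (hGR₀ V c) (hGR₁ V c) (EtaChi.η @χV (@SInstance.χWR @hGR @hGR₀ @hGR₁ @μ) V c) (EtaChi.hηc @χV (@SInstance.χWR @hGR @hGR₀ @hGR₁ @μ) V c) (SInstance.hG_GOG V c hG) ((SInstance.AR @SInstance.GOG @SInstance.hG_GOG @hGR @χV @hGR₀ @hGR₁ @hGR₂ @hGR₃ @μ @SInstance.hpos_GOG @hΔ₁ @hΔ₂ @hΔ₃ V c hG) 0).x₀ N) * (deepIndexOne V c.D (hGR V c) (hGR₀ V c) (hGR₁ V c) (EtaChi.η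 @χV (@SInstance.χWR @hGR @hGR₀ @hGR₁ @μ) V c) (EtaChi.hηc @χV (@SInstance.χWR @hGR @hGR₀ @hGR₁ @μ) V c) ((SInstance.AR @SInstance.GOG @SInstance.hG_GOG @hGR @χV @hGR₀ @hGR₁ @hGR₂ @hGR₃ @μ @SInstance.hpos_GOG @hΔ₁ @hΔ₂ @hΔ₃ V c hG) 1).x₀ N)) (mul_ne_zero (deepIndexZero_ne_zero V c.D (hGR V c) (hGR₀ V c) (hGR₁ V c) (EtaChi.η @χV (@SInstance.χWR @hGR @hGR₀ @hGR₁ @μ) V c) (EtaChi.hηc @χV (@SInstance.χWR @hGR @hGR₀ @hGR₁ @μ) V c) (SInstance.hG_GOG V c hG) ((SInstance.AR @SInstance.GOG @SInstance.hG_GOG @hGR @χV @hGR₀ @hGR₁ @hGR₂ @hGR₃ @μ @SInstance.hpos_GOG @hΔ₁ @hΔ₂ @hΔ₃ V c hG) 0).x₀ N) (deepIndexOne_ne_zero V c.D (hGR V c) (hGR₀ V c) (hGR₁ V c) (EtaChi.η @χV (@SInstance.χWR @hGR @hGR₀ @hGR₁ @μ) V c) (EtaChi.hηc @χV (@SInstance.χWR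 @hGR @hGR₀ @hGR₁ @μ) V c) ((SInstance.AR @SInstance.GOG @SInstance.hG_GOG @hGR @χV @hGR₀ @hGR₁ @hGR₂ @hGR₃ @μ @SInstance.hpos_GOG @hΔ₁ @hΔ₂ @hΔ₃ V c hG) 1).x₀ N)))
          rfl (harch₀ V c hV hG N)
          (hfin_zero_deepLevel V c.D (hGR V c) (hGR₀ V c) (hGR₁ V c) (hGR₂ V c) (hGR₃ V c) (EtaChi.η @χV (@SInstance.χWR @hGR @hGR₀ @hGR₁ @μ) V c) hV (EtaChi.hηc @χV (@SInstance.χWR @hGR @hGR₀ @hGR₁ @μ) V c) (SInstance.hG_GOG V c hG) ((SInstance.AR @SInstance.GOG @SInstance.hG_GOG @hGR @χV @hGR₀ @hGR₁ @hGR₂ @hGR₃ @μ @SInstance.hpos_GOG @hΔ₁ @hΔ₂ @hΔ₃ V c hG) 0).x₀ N (mul_ne_zero (deepIndexZero_ne_zero V c.D (hGR V c) (hGR₀ V c) (hGR₁ V c) (EtaChi.η @χV (@SInstance.χWR @hGR @hGR₀ @hGR₁ @μ) V c) (EtaChi.hηc @χV (@SInstance.χWR @hGR @hGR₀ @hGR₁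 @μ) V c) (SInstance.hG_GOG V c hG) ((SInstance.AR @SInstance.GOG @SInstance.hG_GOG @hGR @χV @hGR₀ @hGR₁ @hGR₂ @hGR₃ @μ @SInstance.hpos_GOG @hΔ₁ @hΔ₂ @hΔ₃ V c hG) 0).x₀ N) (deepIndexOne_ne_zero V c.D (hGR V c) (hGR₀ V c) (hGR₁ V c) (EtaChi.η @χV (@SInstance.χWR @hGR @hGR₀ @hGR₁ @μ) V c) (EtaChi.hηc @χV (@SInstance.χWR @hGR @hGR₀ @hGR₁ @μ) V c) ((SInstance.AR @SInstance.GOG @SInstance.hG_GOG @hGR @χV @hGR₀ @hGR₁ @hGR₂ @hGR₃ @μ @SInstance.hpos_GOG @hΔ₁ @hΔ₂ @hΔ₃ V c hG) 1).x₀ N)) (dvd_mul_right _ _))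
          (hχ₀ V c hG) rfl (harch₁ V c hV hG N)
          (hfin_one_deepLevel V c.D (hGR V c) (hGR₀ V c) (hGR₁ V c) (hGR₂ V c) (hGR₃ V c) (EtaChi.η @χV (@SInstance.χWR @hGR @hGR₀ @hGR₁ @μ) V c) hV (EtaChi.hηc @χV (@SInstance.χWR @hGR @hGR₀ @hGR₁ @μ) V c) ((SInstance.AR @SInstance.GOG @SInstance.hG_GOG @hGR @χV @hGR₀ @hGR₁ @hGR₂ @hGR₃ @μ @SInstance.hpos_GOG @hΔ₁ @hΔ₂ @hΔ₃ V c hG) 1).x₀ N (mul_ne_zero (deepIndexZero_ne_zero V c.D (hGR V c) (hGR₀ V c) (hGR₁ V c) (EtaChi.η @χV (@SInstance.χWR @hGR @hGR₀ @hGR₁ @μ) V c) (EtaChi.hηc @χV (@SInstance.χWR @hGR @hGR₀ @hGR₁ @μ) V c) (SInstance.hG_GOG V c hG) ((SInstance.AR @SInstance.GOG @SInstance.hG_GOG @hGR @χV @hGR₀ @hGR₁ @hGR₂ @hGR₃ @μ @SInstance.hpos_GOG @hΔ₁ @hΔ₂ @hΔ₃ V c hG) 0).x₀ N) (deepIndexOne_ne_zero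 V c.D (hGR V c) (hGR₀ V c) (hGR₁ V c) (EtaChi.η @χV (@SInstance.χWR @hGR @hGR₀ @hGR₁ @μ) V c) (EtaChi.hηc @χV (@SInstance.χWR @hGR @hGR₀ @hGR₁ @μ) V c) ((SInstance.AR @SInstance.GOG @SInstance.hG_GOG @hGR @χV @hGR₀ @hGR₁ @hGR₂ @hGR₃ @μ @SInstance.hpos_GOG @hΔ₁ @hΔ₂ @hΔ₃ V c hG) 1).x₀ N)) (dvd_mul_left _ _))
          (hχ₁ V c hG) k hk p)
        ⟨hcan, (HodgeCM.Universe.AdelicThetaCore.thetaModel_goodCtx_iff _ (orientBitι L ι₁) (d12Of μ) (d34Of μ) ι₁ c).mp hc⟩)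
    gen12 real34 hyp12 hyp34

end Model

end HodgeCM
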